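import Literature.Geometry.Kaehler.SiegelTorusThetaDivisorEtaModularWeight
import Literature.NumberTheory.ModularForms.SiegelThetaConstantsEighthPowers
import HarnessLib

/-!
# De Jong's Thm. 1.3 made exact: on `ϑ = 0`, `η(ᵗ(γZ+δ)⁻¹v, M(Z))⁸ = det(γZ+δ)^{4(n+5)} q(v)^{8(n+1)} η(v,Z)⁸`
# for EVERY `M ∈ Sp_{2g}(ℤ)` and every half-integer characteristic — the automorphy factor
# `det(cτ+d)^{(n+5)/2} ζ_γ^{n+1} q^{n+1}` with `ζ_γ⁸ = 1`, free of any unknown constant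

[tag: lange-cav-complex-tori] [linked: HodgeConjecture (lit-hodgefound SKELETON §A2, row A2-220)]

Layer `Literature/Geometry/Kaehler`, namespace `Literature.Geometry.Kaehler.ComplexTorus`; lane `lit-hodgefound`
(Track 2 foundations library), skeleton seat `lit-hodgefound-skel-2` (generation 44), plan row A2-220 = pointer
(76) of the gen-43 list (its recorded blocker "`κ(M)⁸ = 1`, absent" is now the tree's
`SiegelThetaConstantsEighthPowers.riemannThetaChar_transform_const_pow_eight`: `C⁸ = det(γZ+δ)⁴` for every
half-integer characteristic). A2-210 (`SiegelTorusThetaDivisorEtaModular`) proved de Jong's law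
`η′(ᵗD⁻¹v) = det(D)² (C q(v))^{n+1} η(v)` on `ϑ[c](v,Z) = 0` with the transformation constant `C`; A2-215
(`SiegelTorusThetaDivisorEtaModularWeight`) squared it to `η′² = (u e(2πik))^{n+1} det(D)^{n+5} q^{2(n+1)} η²` with an
UNDETERMINED unit `u = u(M)`. Here the unit is eliminated: to the eighth power the law is EXACT, for all of
`Sp_{2g}(ℤ)` and every theta characteristic `c = (k/2, l/2)`, and — de Jong's own setting — for Riemann's `ϑ`
itself under the theta group `Γ_{1,2}`. Theorems only; no definition, no named fact, net debt `0`.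

Sources, VERBATIM. R. de Jong, *Theta functions on the theta divisor*, Rocky Mountain J. Math. 40 (2010) [held
`paper:arxiv-math_0611810`], §1 (chunk p0003): "the Riemann theta function transforms as
`θ(ᵗ(cτ+d)⁻¹z, (aτ+b)(cτ+d)⁻¹) = ζ_γ det(cτ+d)^{1/2} e^{πi ᵗz(cτ+d)⁻¹cz} θ(z,τ)` for some `8`-th root of unity
`ζ_γ` […] **Theorem 1.3.** The function `η = η(z,τ)` is a theta function of order `n+1` and weight `(n+5)/2` on
the theta divisor. […] the function `η` transforms under the action of `Γ_{1,2}` with an automorphy factor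
`det(cτ+d)^{(n+5)/2}` on `θ⁻¹(0)`"; §4, proof (chunk p0008): "We claim that `η(ᵗ(cτ+d)⁻¹z, (aτ+b)(cτ+d)⁻¹) =
det(cτ+d)^{(n+5)/2} ζ_γ^{n+1} q(z,γ,τ)^{n+1} η(z,τ)` for all `(z,τ)` satisfying `θ(z,τ) = 0`." H. Lange,
*Abelian Varieties over the Complex Numbers* (2023), §3.3.3, remark after Thm. 3.3.9 (p0175): "In particular
`κ(M)` is an 8-th root of unity for every `M ∈ Sp_{2g}(ℤ)`."

Dictionary. `F′ = ϑ[M[c]](·, M(Z))`, `F = ϑ[c](·, Z)` with `c = (k/2, l/2)`, `k, l ∈ ℤ^n`; `D = denom(M,Z) = γZ+δ`;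
`q(v) = e(πi ᵗv D⁻¹γ v)`; `B_F(v)[e]` the bordered Hessian `( D²F(v)(eᵢ,eⱼ) dF(v)(eᵢ) ; dF(v)(eⱼ) 0 )` in the
standard coordinates, `η = det B`.

## Contents

* §1 **`pow_eight_det_borderedHessian_riemannThetaChar_half_moeb_mulVec_eq`** — for every `M ∈ Sp_{2g}(ℤ)`,
  `Z ∈ 𝔥_g`, `k, l ∈ ℤ^n` and `v` with `ϑ[k/2;l/2](v,Z) = 0`:
  `η′(ᵗD⁻¹v)⁸ = det(D)^{4(n+5)} · q(v)^{8(n+1)} · η(v)⁸` (A2-215 §1's single constant `C`, `C⁸ = det(D)⁴`);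
  **`pow_eight_det_borderedHessian_riemannThetaChar_zero_moeb_mulVec_eq`** — the case `c = 0`
  (`F′ = ϑ[M[0]](·, M(Z))`, `F = ϑ[0;0](·,Z)`).
* §2 (the theta group) `riemannThetaChar_thetaChar_zero_eq_riemannTheta_of_mem_thetaModularGroup`
  (`ϑ[M[0]](·, Ω) = ϑ(·, Ω)` as functions for `M ∈ Γ_{1,2}`: `M[0]` is integral), and de Jong's statement as
  printed, to the eighth power: **`pow_eight_det_borderedHessian_riemannTheta_moeb_mulVec_eq`** — for
  `M ∈ Γ_{1,2}`, on `ϑ(v,Z) = 0`, `η_{ϑ(·,M(Z))}(ᵗD⁻¹v)⁸ = det(D)^{4(n+5)} q(v)^{8(n+1)} η_{ϑ(·,Z)}(v)⁸`.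

## References

* [DeJong2010ThetaFunctionsThetaDivisor] R. de Jong, Theta functions on the theta divisor, Rocky Mountain J. Math.
  40 (2010), §1 Thm. 1.3, §4 (proof).
* [Lange2023AbelianVarietiesComplex] H. Lange, Abelian Varieties over the Complex Numbers (2023), §3.3.3 Thm. 3.3.9
  and the remark after it (p0175); §3.5.1 Lemma 3.5.1 (p0186: `Γ_{1,2}`).
* [MumfordTata1] D. Mumford, Tata Lectures on Theta I (1983), Ch. II §5 (the eighth root of unity on `Γ_{1,2}`).
-/

noncomputable section

open scoped Matrix Topology Real
open Set Function Module Complex Matrix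
open Literature.Analysis.SpecialFunctions Literature.Analysis.Complex

namespace Literature.Geometry.Kaehler

namespace ComplexTorus

open Literature.NumberTheory.Automorphic (siegelUpperHalfSpace)
open Literature.NumberTheory.ModularForms.SiegelUpperHalfSpace (moeb denom)
open Literature.NumberTheory.ModularForms (thetaModularGroup mem_thetaModularGroup_iff_thetaChar_zero
  riemannThetaChar_transform_const_pow_eight)

section EtaEighthPower

variable {n : ℕ} {M : Matrix (Fin n ⊕ Fin n) (Fin n ⊕ Fin n) ℤ} {Z : Matrix (Fin n) (Fin n) ℂ}

/-! ### §1 Every `M ∈ Sp_{2g}(ℤ)`, every half-integer characteristic -/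

/-- **DE JONG'S THM. 1.3, MODULAR HALF, EXACT TO THE EIGHTH POWER**: for `M ∈ Sp_{2g}(ℤ)`, `Z ∈ 𝔥_g`, a theta
characteristic `c = (k/2, l/2)` and every `v` with `ϑ[c](v,Z) = 0`,
`η′(ᵗD⁻¹v)⁸ = det(γZ+δ)^{4(n+5)} · q(v)^{8(n+1)} · η(v)⁸` — the printed
`η ↦ det(cτ+d)^{(n+5)/2} ζ_γ^{n+1} q^{n+1} η` with `ζ_γ⁸ = 1` made explicit (`C⁸ = det(γZ+δ)⁴`).
[cite: DeJong2010ThetaFunctionsThetaDivisor, Thm. 1.3 and §4, proof (chunk p0008)] [cite: Lange2023AbelianVarietiesComplex, §3.3.3 Thm. 3.3.9 and the remark after it (p0175: "`κ(M)` is an 8-th root of unity")] -/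
theorem pow_eight_det_borderedHessian_riemannThetaChar_half_moeb_mulVec_eq
    (hM : M ∈ Matrix.symplecticGroup (Fin n) ℤ) (hZ : Z ∈ siegelUpperHalfSpace n) (k l : Fin n → ℤ)
    {v : Fin n → ℂ} (hv : riemannThetaChar (fun i => (k i : ℂ) / 2) (fun i => (l i : ℂ) / 2) Z v = 0) :
    (Matrix.fromBlocks
        (Matrix.of fun i j : Fin n => fderiv ℂ (fderiv ℂ (riemannThetaChar
          (thetaCharFst M (fun i => (k i : ℂ) / 2) (fun i => (l i : ℂ) / 2))
          (thetaCharSnd M (fun i => (k i : ℂ) / 2) (fun i => (l i : ℂ) / 2)) (moeb (M.map ((↑) : ℤ → ℂ)) Z)))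
          ((denom (M.map ((↑) : ℤ → ℂ)) Z)ᵀ⁻¹ *ᵥ v) (Pi.single i (1 : ℂ)) (Pi.single j (1 : ℂ)))
        (Matrix.of fun (i : Fin n) (_ : Unit) => fderiv ℂ (riemannThetaChar
          (thetaCharFst M (fun i => (k i : ℂ) / 2) (fun i => (l i : ℂ) / 2))
          (thetaCharSnd M (fun i => (k i : ℂ) / 2) (fun i => (l i : ℂ) / 2)) (moeb (M.map ((↑) : ℤ → ℂ)) Z))
          ((denom (M.map ((↑) : ℤ → ℂ)) Z)ᵀ⁻¹ *ᵥ v) (Pi.single i (1 : ℂ)))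
        (Matrix.of fun (_ : Unit) (j : Fin n) => fderiv ℂ (riemannThetaChar
          (thetaCharFst M (fun i => (k i : ℂ) / 2) (fun i => (l i : ℂ) / 2))
          (thetaCharSnd M (fun i => (k i : ℂ) / 2) (fun i => (l i : ℂ) / 2)) (moeb (M.map ((↑) : ℤ → ℂ)) Z))
          ((denom (M.map ((↑) : ℤ → ℂ)) Z)ᵀ⁻¹ *ᵥ v) (Pi.single j (1 : ℂ)))
        (0 : Matrix Unit Unit ℂ)).det ^ 8 =
      (denom (M.map ((↑) : ℤ → ℂ)) Z).det ^ (4 * (n + 5)) *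
        cexp (π * I * (v ⬝ᵥ ((denom (M.map ((↑) : ℤ → ℂ)) Z)⁻¹ *
          (M.map ((↑) : ℤ → ℂ)).toBlocks₂₁) *ᵥ v)) ^ (8 * (n + 1)) *
        (Matrix.fromBlocks
          (Matrix.of fun i j : Fin n => fderiv ℂ (fderiv ℂ
            (riemannThetaChar (fun i => (k i : ℂ) / 2) (fun i => (l i : ℂ) / 2) Z)) v
            (Pi.single i (1 : ℂ)) (Pi.single j (1 : ℂ)))
          (Matrix.of fun (i : Fin n) (_ : Unit) => fderiv ℂ
            (riemannThetaChar (fun i => (k i : ℂ) / 2) (fun i => (l i : ℂ) / 2) Z) v (Pi.single i (1 : ℂ)))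
          (Matrix.of fun (_ : Unit) (j : Fin n) => fderiv ℂ
            (riemannThetaChar (fun i => (k i : ℂ) / 2) (fun i => (l i : ℂ) / 2) Z) v (Pi.single j (1 : ℂ)))
          (0 : Matrix Unit Unit ℂ)).det ^ 8 := by
  obtain ⟨C, -, hCF, hdet⟩ := exists_riemannThetaChar_transform_and_det_borderedHessian_eq hM hZ
    (fun i => (k i : ℂ) / 2) (fun i => (l i : ℂ) / 2)
  have hC8 : C ^ 8 = (denom (M.map ((↑) : ℤ → ℂ)) Z).det ^ 4 :=
    riemannThetaChar_transform_const_pow_eight hM hZ k l hCF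
  rw [hdet v hv]
  generalize (Matrix.fromBlocks
      (Matrix.of fun i j : Fin n => fderiv ℂ (fderiv ℂ
        (riemannThetaChar (fun i => (k i : ℂ) / 2) (fun i => (l i : ℂ) / 2) Z)) v
        (Pi.single i (1 : ℂ)) (Pi.single j (1 : ℂ)))
      (Matrix.of fun (i : Fin n) (_ : Unit) => fderiv ℂ
        (riemannThetaChar (fun i => (k i : ℂ) / 2) (fun i => (l i : ℂ) / 2) Z) v (Pi.single i (1 : ℂ)))
      (Matrix.of fun (_ : Unit) (j : Fin n) => fderiv ℂ
        (riemannThetaChar (fun i => (k i : ℂ) / 2) (fun i => (l i : ℂ) / 2) Z) v (Pi.single j (1 : ℂ)))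
      (0 : Matrix Unit Unit ℂ)).det = η
  generalize cexp (π * I * (v ⬝ᵥ ((denom (M.map ((↑) : ℤ → ℂ)) Z)⁻¹ *
    (M.map ((↑) : ℤ → ℂ)).toBlocks₂₁) *ᵥ v)) = q
  generalize hd : (denom (M.map ((↑) : ℤ → ℂ)) Z).det = d
  rw [hd] at hC8
  rw [show (d ^ 2 * (C * q) ^ (n + 1) * η) ^ 8 = d ^ 16 * (C ^ 8) ^ (n + 1) * q ^ (8 * (n + 1)) * η ^ 8 by ring,
    hC8]
  ring

/-- **The case `c = 0`**: for every `M ∈ Sp_{2g}(ℤ)`, `Z ∈ 𝔥_g` and `v` with `ϑ(v,Z) = 0`, with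
`F′ = ϑ[M[0]](·, M(Z))`: `η_{F′}(ᵗD⁻¹v)⁸ = det(γZ+δ)^{4(n+5)} · q(v)^{8(n+1)} · η_{ϑ(·,Z)}(v)⁸` — A2-215's
`η′² = u^{n+1} det^{n+5} q^{2(n+1)} η²` with the unit `u` eliminated (`u⁴ = 1`).
[cite: DeJong2010ThetaFunctionsThetaDivisor, Thm. 1.3 and §4, proof (chunk p0008)] [cite: Lange2023AbelianVarietiesComplex, §3.3.3 Thm. 3.3.9 and the remark after it (p0175)] -/
theorem pow_eight_det_borderedHessian_riemannThetaChar_zero_moeb_mulVec_eq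
    (hM : M ∈ Matrix.symplecticGroup (Fin n) ℤ) (hZ : Z ∈ siegelUpperHalfSpace n)
    {v : Fin n → ℂ} (hv : riemannThetaChar 0 0 Z v = 0) :
    (Matrix.fromBlocks
        (Matrix.of fun i j : Fin n => fderiv ℂ (fderiv ℂ (riemannThetaChar (thetaCharFst M 0 0)
          (thetaCharSnd M 0 0) (moeb (M.map ((↑) : ℤ → ℂ)) Z)))
          ((denom (M.map ((↑) : ℤ → ℂ)) Z)ᵀ⁻¹ *ᵥ v) (Pi.single i (1 : ℂ)) (Pi.single j (1 : ℂ)))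
        (Matrix.of fun (i : Fin n) (_ : Unit) => fderiv ℂ (riemannThetaChar (thetaCharFst M 0 0)
          (thetaCharSnd M 0 0) (moeb (M.map ((↑) : ℤ → ℂ)) Z))
          ((denom (M.map ((↑) : ℤ → ℂ)) Z)ᵀ⁻¹ *ᵥ v) (Pi.single i (1 : ℂ)))
        (Matrix.of fun (_ : Unit) (j : Fin n) => fderiv ℂ (riemannThetaChar (thetaCharFst M 0 0)
          (thetaCharSnd M 0 0) (moeb (M.map ((↑) : ℤ → ℂ)) Z))
          ((denom (M.map ((↑) : ℤ → ℂ)) Z)ᵀ⁻¹ *ᵥ v) (Pi.single j (1 : ℂ)))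
        (0 : Matrix Unit Unit ℂ)).det ^ 8 =
      (denom (M.map ((↑) : ℤ → ℂ)) Z).det ^ (4 * (n + 5)) *
        cexp (π * I * (v ⬝ᵥ ((denom (M.map ((↑) : ℤ → ℂ)) Z)⁻¹ *
          (M.map ((↑) : ℤ → ℂ)).toBlocks₂₁) *ᵥ v)) ^ (8 * (n + 1)) *
        (Matrix.fromBlocks
          (Matrix.of fun i j : Fin n => fderiv ℂ (fderiv ℂ (riemannThetaChar 0 0 Z)) v
            (Pi.single i (1 : ℂ)) (Pi.single j (1 : ℂ)))
          (Matrix.of fun (i : Fin n) (_ : Unit) => fderiv ℂ (riemannThetaChar 0 0 Z) v (Pi.single i (1 : ℂ)))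
          (Matrix.of fun (_ : Unit) (j : Fin n) => fderiv ℂ (riemannThetaChar 0 0 Z) v (Pi.single j (1 : ℂ)))
          (0 : Matrix Unit Unit ℂ)).det ^ 8 := by
  have h0 : (fun i => (((0 : Fin n → ℤ) i : ℤ) : ℂ) / 2) = (0 : Fin n → ℂ) := by
    funext i
    simp
  have h := pow_eight_det_borderedHessian_riemannThetaChar_half_moeb_mulVec_eq hM hZ 0 0 (v := v)
    (by rw [h0]; exact hv)
  simpa only [h0] using h

/-! ### §2 The theta group `Γ_{1,2}`: Riemann's `ϑ` on both sides -/

/-- For `M ∈ Γ_{1,2}` the transformed characteristic `M[0]` is integral, so `ϑ[M[0]](·, Ω) = ϑ(·, Ω)` as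
functions (integral characteristics do not change `ϑ[0;0] = ϑ`).
[cite: Lange2023AbelianVarietiesComplex, §3.5.1 Lemma 3.5.1 (a) (p0186); §3.3.4 Exercise (3) (p0178)] -/
theorem riemannThetaChar_thetaChar_zero_eq_riemannTheta_of_mem_thetaModularGroup
    {M : Matrix.symplecticGroup (Fin n) ℤ} (hM : M ∈ thetaModularGroup n) (Ω : Matrix (Fin n) (Fin n) ℂ) :
    riemannThetaChar (thetaCharFst (M : Matrix (Fin n ⊕ Fin n) (Fin n ⊕ Fin n) ℤ) 0 0)
        (thetaCharSnd (M : Matrix (Fin n ⊕ Fin n) (Fin n ⊕ Fin n) ℤ) 0 0) Ω = riemannTheta Ω := by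
  obtain ⟨n₁, n₂, h₁, h₂⟩ := (mem_thetaModularGroup_iff_thetaChar_zero M).1 hM
  funext z
  rw [h₁, h₂, show (fun i => (n₁ i : ℂ)) = 0 + fun i => (n₁ i : ℂ) from (zero_add _).symm,
    show (fun i => (n₂ i : ℂ)) = 0 + fun i => (n₂ i : ℂ) from (zero_add _).symm,
    riemannThetaChar_charShift, zero_dotProduct, mul_zero, Complex.exp_zero, one_mul,
    riemannThetaChar_zero_zero]

/-- **DE JONG'S THM. 1.3 AS PRINTED, TO THE EIGHTH POWER**: for `M = (α β; γ δ)` in the theta group `Γ_{1,2}`,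
`Z ∈ 𝔥_g` and every `v` with `ϑ(v,Z) = 0`, the bordered-Hessian determinant `η` of Riemann's `ϑ` satisfies
`η(ᵗ(γZ+δ)⁻¹v, M(Z))⁸ = det(γZ+δ)^{4(n+5)} · e(πi ᵗv(γZ+δ)⁻¹γv)^{8(n+1)} · η(v,Z)⁸` — "`η` transforms under the
action of `Γ_{1,2}` with an automorphy factor `det(cτ+d)^{(n+5)/2}` on `θ⁻¹(0)`", "`ζ_γ` an 8-th root of unity".
[cite: DeJong2010ThetaFunctionsThetaDivisor, Thm. 1.3 (chunk p0003) and §4, proof (chunk p0008)] [cite: MumfordTata1, Ch. II §5] -/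
theorem pow_eight_det_borderedHessian_riemannTheta_moeb_mulVec_eq
    {M : Matrix.symplecticGroup (Fin n) ℤ} (hM : M ∈ thetaModularGroup n) (hZ : Z ∈ siegelUpperHalfSpace n)
    {v : Fin n → ℂ} (hv : riemannTheta Z v = 0) :
    (Matrix.fromBlocks
        (Matrix.of fun i j : Fin n => fderiv ℂ (fderiv ℂ (riemannTheta
          (moeb ((M : Matrix (Fin n ⊕ Fin n) (Fin n ⊕ Fin n) ℤ).map ((↑) : ℤ → ℂ)) Z)))
          ((denom ((M : Matrix (Fin n ⊕ Fin n) (Fin n ⊕ Fin n) ℤ).map ((↑) : ℤ → ℂ)) Z)ᵀ⁻¹ *ᵥ v)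
          (Pi.single i (1 : ℂ)) (Pi.single j (1 : ℂ)))
        (Matrix.of fun (i : Fin n) (_ : Unit) => fderiv ℂ (riemannTheta
          (moeb ((M : Matrix (Fin n ⊕ Fin n) (Fin n ⊕ Fin n) ℤ).map ((↑) : ℤ → ℂ)) Z))
          ((denom ((M : Matrix (Fin n ⊕ Fin n) (Fin n ⊕ Fin n) ℤ).map ((↑) : ℤ → ℂ)) Z)ᵀ⁻¹ *ᵥ v)
          (Pi.single i (1 : ℂ)))
        (Matrix.of fun (_ : Unit) (j : Fin n) => fderiv ℂ (riemannTheta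
          (moeb ((M : Matrix (Fin n ⊕ Fin n) (Fin n ⊕ Fin n) ℤ).map ((↑) : ℤ → ℂ)) Z))
          ((denom ((M : Matrix (Fin n ⊕ Fin n) (Fin n ⊕ Fin n) ℤ).map ((↑) : ℤ → ℂ)) Z)ᵀ⁻¹ *ᵥ v)
          (Pi.single j (1 : ℂ)))
        (0 : Matrix Unit Unit ℂ)).det ^ 8 =
      (denom ((M : Matrix (Fin n ⊕ Fin n) (Fin n ⊕ Fin n) ℤ).map ((↑) : ℤ → ℂ)) Z).det ^ (4 * (n + 5)) *
        cexp (π * I * (v ⬝ᵥ ((denom ((M : Matrix (Fin n ⊕ Fin n) (Fin n ⊕ Fin n) ℤ).map ((↑) : ℤ → ℂ)) Z)⁻¹ *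
          ((M : Matrix (Fin n ⊕ Fin n) (Fin n ⊕ Fin n) ℤ).map ((↑) : ℤ → ℂ)).toBlocks₂₁) *ᵥ v)) ^ (8 * (n + 1)) *
        (Matrix.fromBlocks
          (Matrix.of fun i j : Fin n => fderiv ℂ (fderiv ℂ (riemannTheta Z)) v
            (Pi.single i (1 : ℂ)) (Pi.single j (1 : ℂ)))
          (Matrix.of fun (i : Fin n) (_ : Unit) => fderiv ℂ (riemannTheta Z) v (Pi.single i (1 : ℂ)))
          (Matrix.of fun (_ : Unit) (j : Fin n) => fderiv ℂ (riemannTheta Z) v (Pi.single j (1 : ℂ)))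
          (0 : Matrix Unit Unit ℂ)).det ^ 8 := by
  have hθ : riemannThetaChar (0 : Fin n → ℂ) 0 Z = riemannTheta Z := funext (riemannThetaChar_zero_zero Z)
  have h := pow_eight_det_borderedHessian_riemannThetaChar_zero_moeb_mulVec_eq M.2 hZ (v := v)
    (by rw [riemannThetaChar_zero_zero]; exact hv)
  rw [riemannThetaChar_thetaChar_zero_eq_riemannTheta_of_mem_thetaModularGroup hM, hθ] at h
  exact h

end EtaEighthPower

end ComplexTorus

end Literature.Geometry.Kaehler
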